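import Summits.Ventures.PercRepro.RankLevelSetHallCapLymCount

/-!
# PercRepro — THE CAPPED-LYM RECEIPTS ARE A `Z`-LOCAL BINOMIAL SUM: THE UP-HALL FORM OF C-044 AT THE TIGHT LAYER REDUCES TO
THE INEQUALITY `CapIneq` (p4, gen 38; paper proofs/P4-CAP-KERNEL.md §3)

For a member `Z` with `F = cl Z`, `D = F ∖ Z` (`d = #D`), `O = E ∖ F` (`ω = #O = p − d`): the sets `Z ∪ Y' ∪ U` (`Y' ⊆ D`,
`U ⊆ O`, `1 ≤ #U ≤ k − 1`, `k = p − q`) are distinct `Y`-sets (`mem_cellY_union`, `union_sdiff_closure`, `union_inter_closure`),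
`C(d, j) · C(ω, i)` of them at `(#Y', #U) = (j, i)`, each paying `Z` at least `1 / m̂(q, d, j, i)` (`capCount_union_le`).  Summing:
**`capG_le_capWeight_recv`** — every member receives at least `G(q, k, d) = Σ_{i=1}^{k−1} C(q + k − d, i) Σ_{j ≤ d} C(d, j)/m̂(q, d, j, i)`.
Hence `CapIneq q k` (`∀ d ≤ q, Φ(q+k, q) ≤ G(q, k, d)` — binomial coefficients only; it holds for `q ≤ 71` (exact evaluation, `k ≤ 40`),
for `d ≤ 1` and for `k = 2`, and FAILS from `q = 72` — P4-CAP-KERNEL Addendum 2) gives `CapRecv` (`capRecv_of_capIneq`) and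
**`hallUp_of_ncard_eq_of_capIneq`**: `CapIneq q (p − q)` implies the UP-Hall form of C-044 at the tight layer `#E = p + q` for every
family of members — the matroid content of the lane's `k ≥ 3` problem is exhausted; what remains is `CapIneq`.

* **`capG_le_capWeight_recv`**, `capRecv_of_capIneq`, **`hallUp_of_ncard_eq_of_capIneq`**.
Axioms: standard.
-/

namespace PercRepro

open Set Matroid Finset

variable {α : Type} (M : Matroid α) [M.Finite]

/-- **Every member receives at least `G(q, k, d)`** under the capped-LYM kernel at the tight layer (`k = p − q ≥ 2`): the sets
`Z ∪ Y' ∪ U` (`Y' ⊆ cl Z ∖ Z`, `U ⊆ E ∖ cl Z`, `1 ≤ #U ≤ k − 1`) are distinct `Y`-sets, `C(d, j) · C(ω, i)` of them at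
`(#Y', #U) = (j, i)`, each paying at least `1 / m̂(q, d, j, i)`. -/
theorem capG_le_capWeight_recv (p q : ℕ) (hp : q + 2 ≤ p) (hE : M.E.ncard = p + q) {Z : Set α}
    (hZ : Z ∈ cellMembers M p q) :
    capG q (p - q) (M.closure Z \ Z).ncard ≤ ∑ S ∈ (cellY_finite M p q).toFinset, capWeight M p q Z S := by
  classical
  have hZE : Z ⊆ M.E := hZ.1
  have hZq : Z.ncard = q := ncard_eq_q_of_mem_cellMembers_tight M hE hZ
  set k : ℕ := p - q with hk
  set F : Set α := M.closure Z with hF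
  have hFE : F ⊆ M.E := M.closure_subset_ground Z
  have hZF : Z ⊆ F := M.subset_closure Z hZE
  set D : Set α := F \ Z with hD
  set O : Set α := M.E \ F with hO
  have hEfin : M.E.Finite := M.set_finite M.E
  have hFfin : F.Finite := hEfin.subset hFE
  have hDfin : D.Finite := hFfin.subset sdiff_subset
  have hOfin : O.Finite := hEfin.subset sdiff_subset
  -- d ≤ q and ω = p − d
  have hDind : M.Indep D := (compl_indep_of_mem_U M hE hZ).1.subset (fun x hx => ⟨hFE hx.1, hx.2⟩)
  have hd_le : D.ncard ≤ q := by
    have h := hDind.encard_le_eRk_of_subset (sdiff_subset : D ⊆ F)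
    rw [hF, M.eRk_closure_eq, hZ.2.1, ← hDfin.cast_ncard_eq] at h
    exact_mod_cast h
  have hFcard : F.ncard = q + D.ncard := by
    have := Set.ncard_sdiff_add_ncard_of_subset hZF hFfin
    rw [← hD, hZq] at this
    omega
  have hOcard : O.ncard = p - D.ncard := by
    have := Set.ncard_sdiff_add_ncard_of_subset hFE hEfin
    rw [← hO, hE, hFcard] at this
    omega
  set Df : Finset α := hDfin.toFinset with hDf
  set Of : Finset α := hOfin.toFinset with hOf
  have hDcard : Df.card = D.ncard := by rw [hDf, ← ncard_eq_toFinset_card _ hDfin]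
  have hOcard' : Of.card = O.ncard := by rw [hOf, ← ncard_eq_toFinset_card _ hOfin]
  have hmemD : ∀ x, x ∈ Df ↔ x ∈ D := fun x => by rw [hDf, hDfin.mem_toFinset]
  have hmemO : ∀ x, x ∈ Of ↔ x ∈ O := fun x => by rw [hOf, hOfin.mem_toFinset]
  set Yf : Finset (Set α) := (cellY_finite M p q).toFinset with hYf
  have hmemY : ∀ S, S ∈ Yf ↔ S ∈ cellY M p q := fun S => by
    rw [hYf, (cellY_finite M p q).mem_toFinset]
  -- the index set: pairs (Y', U), Y' ⊆ D, U ⊆ O with 1 ≤ #U ≤ k − 1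
  set UI : Finset (Finset α) := (Finset.Ico 1 k).biUnion (fun i => Of.powersetCard i) with hUI
  set P : Finset (Finset α × Finset α) := Df.powerset ×ˢ UI with hP
  let φ : Finset α × Finset α → Set α := fun pr => Z ∪ (pr.1 : Set α) ∪ (pr.2 : Set α)
  have hpair : ∀ pr ∈ P, (pr.1 : Set α) ⊆ D ∧ (pr.2 : Set α) ⊆ O ∧ 1 ≤ pr.2.card ∧ pr.2.card < k := by
    intro pr hpr
    rw [hP, Finset.mem_product, Finset.mem_powerset, hUI, Finset.mem_biUnion] at hpr
    obtain ⟨h1, i, hi, h2⟩ := hpr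
    rw [Finset.mem_Ico] at hi
    rw [Finset.mem_powersetCard] at h2
    refine ⟨?_, ?_, ?_, ?_⟩
    · intro x hx
      exact (hmemD x).1 (h1 (Finset.mem_coe.1 hx))
    · intro x hx
      exact (hmemO x).1 (h2.1 (Finset.mem_coe.1 hx))
    · omega
    · omega
  have hU_sub : ∀ pr ∈ P, (pr.2 : Set α) ⊆ M.E \ M.closure Z := fun pr hpr => (hpair pr hpr).2.1
  have hY'_sub : ∀ pr ∈ P, (pr.1 : Set α) ⊆ M.closure Z \ Z := fun pr hpr => (hpair pr hpr).1
  -- the image lies in Yf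
  have himage : P.image φ ⊆ Yf := by
    intro S hS
    rw [Finset.mem_image] at hS
    obtain ⟨pr, hpr, rfl⟩ := hS
    obtain ⟨-, -, h1, h2⟩ := hpair pr hpr
    rw [hmemY]
    refine mem_cellY_union M p q hZ (hY'_sub pr hpr) (hU_sub pr hpr) (Finset.finite_toSet _) ?_ ?_
    · rw [ncard_coe_finset]; exact h1
    · rw [ncard_coe_finset]; omega
  -- φ is injective on P
  have hinj : ∀ pr ∈ P, ∀ pr' ∈ P, φ pr = φ pr' → pr = pr' := by
    intro pr hpr pr' hpr' heq
    have hdisj : ∀ pr'' ∈ P, Disjoint (pr''.2 : Set α) (M.closure Z) := by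
      intro pr'' hpr''
      rw [Set.disjoint_left]
      intro x hx hxcl
      exact (hU_sub pr'' hpr'' hx).2 hxcl
    have hs1 := union_sdiff_closure M Z _ _ hZE ((hY'_sub pr hpr).trans sdiff_subset) (hdisj pr hpr)
    have hs1' := union_sdiff_closure M Z _ _ hZE ((hY'_sub pr' hpr').trans sdiff_subset) (hdisj pr' hpr')
    have hs2 := union_inter_closure M Z _ _ hZE ((hY'_sub pr hpr).trans sdiff_subset) (hdisj pr hpr)
    have hs2' := union_inter_closure M Z _ _ hZE ((hY'_sub pr' hpr').trans sdiff_subset) (hdisj pr' hpr')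
    have hU : pr.2 = pr'.2 := by
      apply Finset.coe_injective
      rw [← hs1, ← hs1']
      show φ pr \ M.closure Z = φ pr' \ M.closure Z
      rw [heq]
    have hY : pr.1 = pr'.1 := by
      have hUn : Z ∪ (pr.1 : Set α) = Z ∪ (pr'.1 : Set α) := by
        rw [← hs2, ← hs2']
        show φ pr ∩ M.closure Z = φ pr' ∩ M.closure Z
        rw [heq]
      have hdiff : ∀ Y : Finset α, (Y : Set α) ⊆ D → (Z ∪ (Y : Set α)) \ Z = (Y : Set α) := by
        intro Y hY
        ext x
        simp only [Set.mem_sdiff, Set.mem_union]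
        constructor
        · rintro ⟨h | h, hx⟩
          · exact absurd h hx
          · exact h
        · intro h
          exact ⟨Or.inr h, (hY h).2⟩
      apply Finset.coe_injective
      rw [← hdiff pr.1 (hpair pr hpr).1, ← hdiff pr'.1 (hpair pr' hpr').1, hUn]
    exact Prod.ext hY hU
  -- each pair pays at least 1 / m̂(q, d, #Y', #U)
  have hstep3 : ∑ pr ∈ P, (1 / ((capMhat q D.ncard pr.1.card pr.2.card : ℕ) : ℚ))
      ≤ ∑ pr ∈ P, capWeight M p q Z (φ pr) := by
    apply Finset.sum_le_sum
    intro pr hpr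
    obtain ⟨-, -, h1, h2⟩ := hpair pr hpr
    have hmemY' : φ pr ∈ cellY M p q := (hmemY _).1 (himage (Finset.mem_image_of_mem φ hpr))
    have hZsub : Z ⊆ φ pr := Set.subset_union_left.trans Set.subset_union_left
    unfold capWeight
    rw [if_pos ⟨hZ, hZsub, hmemY'⟩]
    have hcnt := capCount_union_le M q hZE hZq (hY'_sub pr hpr) (hU_sub pr hpr)
    rw [ncard_coe_finset, ncard_coe_finset] at hcnt
    have hpos : (0 : ℚ) < ((capCount M q Z (φ pr) : ℕ) : ℚ) := by
      have hZmem : Z ∈ capSet M q Z (φ pr) := by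
        refine ⟨hZsub, hZq, ?_⟩
        rw [Set.sdiff_eq_empty.2 (M.subset_closure Z hZE), Set.ncard_empty]
        exact Nat.zero_le _
      have hne : (capSet M q Z (φ pr)).Nonempty := ⟨Z, hZmem⟩
      have := (Set.ncard_pos (capSet_finite M q Z (φ pr) hmemY'.1)).2 hne
      exact_mod_cast this
    exact one_div_le_one_div_of_le hpos (by exact_mod_cast hcnt)
  -- the pair sum is G(q, k, d)
  have hstep4 : ∑ pr ∈ P, (1 / ((capMhat q D.ncard pr.1.card pr.2.card : ℕ) : ℚ)) = capG q k D.ncard := by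
    rw [hP, Finset.sum_product]
    -- inner sum over U ∈ UI = Σ_{i ∈ Ico 1 k} C(ω, i)·f(#Y', i)
    have hinner : ∀ Y : Finset α, ∑ U ∈ UI, (1 / ((capMhat q D.ncard Y.card U.card : ℕ) : ℚ))
        = ∑ i ∈ Finset.Ico 1 k, ((Of.card.choose i : ℕ) : ℚ) * (1 / ((capMhat q D.ncard Y.card i : ℕ) : ℚ)) := by
      intro Y
      rw [hUI, Finset.sum_biUnion]
      · apply Finset.sum_congr rfl
        intro i _
        rw [Finset.sum_congr rfl (fun U hU => by rw [(Finset.mem_powersetCard.1 hU).2]),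
          Finset.sum_const, Finset.card_powersetCard, nsmul_eq_mul]
      · intro i _ j _ hij
        exact Of.pairwise_disjoint_powersetCard hij
    rw [Finset.sum_congr rfl (fun Y _ => hinner Y)]
    rw [Finset.sum_powerset_apply_card (fun m => ∑ i ∈ Finset.Ico 1 k,
      ((Of.card.choose i : ℕ) : ℚ) * (1 / ((capMhat q D.ncard m i : ℕ) : ℚ)))]
    unfold capG
    rw [Finset.sum_congr rfl (fun m _ => Finset.smul_sum), Finset.sum_comm, hDcard]
    apply Finset.sum_congr rfl
    intro i _
    rw [Finset.mul_sum]
    apply Finset.sum_congr rfl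
    intro j _
    rw [nsmul_eq_mul, hOcard', hOcard]
    have hω : p - D.ncard = q + k - D.ncard := by omega
    rw [hω]
    ring
  -- assemble
  have hstep1 : ∑ S ∈ P.image φ, capWeight M p q Z S ≤ ∑ S ∈ Yf, capWeight M p q Z S :=
    Finset.sum_le_sum_of_subset_of_nonneg himage (fun S _ _ => capWeight_nonneg M p q Z S)
  have hstep2 : ∑ S ∈ P.image φ, capWeight M p q Z S = ∑ pr ∈ P, capWeight M p q Z (φ pr) :=
    Finset.sum_image hinj
  calc capG q k D.ncard = ∑ pr ∈ P, (1 / ((capMhat q D.ncard pr.1.card pr.2.card : ℕ) : ℚ)) := hstep4.symm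
    _ ≤ ∑ pr ∈ P, capWeight M p q Z (φ pr) := hstep3
    _ = ∑ S ∈ P.image φ, capWeight M p q Z S := hstep2.symm
    _ ≤ ∑ S ∈ Yf, capWeight M p q Z S := hstep1

/-- `CapIneq q (p − q)` gives the receipt condition of the capped-LYM kernel at the tight layer. -/
theorem capRecv_of_capIneq (p q : ℕ) (hp : q + 2 ≤ p) (hE : M.E.ncard = p + q) (h : CapIneq q (p - q)) :
    CapRecv M p q := by
  intro Z hZ
  have hd_le : (M.closure Z \ Z).ncard ≤ q := by
    have hDind : M.Indep (M.closure Z \ Z) :=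
      (compl_indep_of_mem_U M hE hZ).1.subset (fun x hx => ⟨M.closure_subset_ground Z hx.1, hx.2⟩)
    have hDfin : (M.closure Z \ Z).Finite := (M.set_finite _ (M.closure_subset_ground Z)).subset sdiff_subset
    have h := hDind.encard_le_eRk_of_subset (sdiff_subset : M.closure Z \ Z ⊆ M.closure Z)
    rw [M.eRk_closure_eq, hZ.2.1, ← hDfin.cast_ncard_eq] at h
    exact_mod_cast h
  have hpq : q + (p - q) = p := by omega
  calc phiK p q = phiK (q + (p - q)) q := by rw [hpq]
    _ ≤ capG q (p - q) (M.closure Z \ Z).ncard := h _ hd_le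
    _ ≤ ∑ S ∈ (cellY_finite M p q).toFinset, capWeight M p q Z S := capG_le_capWeight_recv M p q hp hE hZ

/-- **THE UP-HALL FORM OF C-044 AT THE TIGHT LAYER, FOR EVERY `k`, FROM THE BINOMIAL INEQUALITY**: if `CapIneq q (p − q)` holds
then for every finite matroid with `#E = p + q` (`q + 2 ≤ p`) and every family `𝒜` of members of the cell `(p, q)`,
`Φ(p, q) · #𝒜 ≤ #upNbhd(𝒜)`. -/
theorem hallUp_of_ncard_eq_of_capIneq (p q : ℕ) (hp : q + 2 ≤ p) (hE : M.E.ncard = p + q) (h : CapIneq q (p - q))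
    (𝒜 : Set (Set α)) (h𝒜 : 𝒜 ⊆ cellMembers M p q) :
    phiK p q * (𝒜.ncard : ℚ) ≤ ((upNbhd M p q 𝒜).ncard : ℚ) :=
  hallUp_of_capRecv M p q hE (capRecv_of_capIneq M p q hp hE h) 𝒜 h𝒜

end PercRepro
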